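import Mathlib
import Literature.NumberTheory.LFunctions.Zhang2022.TypedSection12B
import HarnessLib

/-!
# Zhang (2022) §12, Lemma 12.3: the evaluation form from the displayed steps of its proof
# (the `O(𝓛⁻¹⁵)` of the circle step carried through `∂_w|_{w=0}` by Cauchy's estimate), kernel-checked

Topic `Literature/NumberTheory/LFunctions/Zhang2022` (Landau–Siegel audit tree; verdict-neutral).
Y. Zhang, *Discrete mean estimates and the Landau–Siegel zero*, arXiv:2211.02515v1 (2022)
[Zhang2022LandauSiegel] — **an unrefereed manuscript under adjudication; nothing here asserts or
denies its Theorems 1–2, and no claim about Landau–Siegel zeros is made.** Cell siegel-zhang, D-0069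
campaign, discharge seat sz-d60 (L3 free item F4: the Lemma 12.3 deduction, cone leaf C32
`Skeleton.Lemma123 c′` of `theorem1_of_leaves`); the displayed steps are L3-t5's typed nodes
(`TypedSection12B`, namespace `…Typed.Sec12B`), cited BY NAME as hypotheses, never restated.

The printed proof of Lemma 12.3 [Z22 pp. 70–71, tex L3558–L3590]: the `l`-sum is
`−(1/log P₁)∂_w{(dr/P″₁)^{β₆−w}Σ_{l<P″₂/dr} χ(l)ξ_j(l;d,r)l^{−(1−β₆+w)}}|_{w=0}` (Z22:§12.u029,
`U029`, exact); "Assume `|w| = α`. In a way similar to the proof of Lemma 12.1, we deduce that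
`Σ_{l<P″₂/dr} … = L′(1,χ)Π(d,r)·(2πi)⁻¹∫_{|s|=5α} … + O(𝓛⁻¹⁵)`" (u030, `U030`, the one analytic CLAIM);
"By direct calculation" the circle integral is `w − β₆ + β_{j+1} + β_{j+2} + β_{j+1}β_{j+2}
∫₁^{P″₂/dr} y^{β₆−w−1}dy` (u031, `U031`, exact); "Hence … the left side is `(L′(1,χ)Π(d,r)/log P₁)`
times the derivative of [`F032`] at `w = 0`, which is equal to [`rhs033`]" (u033, `U033`, exact);
and "This can be written as the form `1 − (−2β₆+β_{j+1}+β_{j+2})log(dr/P″₁) − ε₂ⱼ(dr)`,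
`|ε₂ⱼ(dr)| < 10⁻⁵`" (u034, `U034`; certified numerics N-07 say the bound fails pointwise as printed —
not used in the main theorem below).

What the kernel checks here is the one step the text passes over in silence at "Hence": the
`O(𝓛⁻¹⁵)` of u030 holds on the CIRCLE `|w| = α`, while u029 differentiates at the CENTRE `w = 0`.
With `E(w) := (dr/P″₁)^{β₆−w}Σ_{l<P″₂/dr}(…) − L′(1,χ)Π(d,r)·F032(w)` — holomorphic on a
neighbourhood of `|w| ≤ α` (`β₆ = 3iα/2` lies outside `|w| ≤ 1.2α`, where the `y`-integral of `F032`
is `((P″₂/dr)^{β₆−w} − 1)/(β₆ − w)`) — and, by u031, `E(w) = (dr/P″₁)^{β₆−w}·(Σ − L′Π·circ)` on the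
circle, one has `|E(w)| ≤ (dr/P″₁)^{α}·C𝓛⁻¹⁵ ≤ e^{π}C𝓛⁻¹⁵` there (`dr/P″₁ < P`, `α log P = π`), hence
`|E′(0)| ≤ e^{π}C𝓛⁻¹⁵/α = (e^{π}C/π)𝓛⁻⁶` (Cauchy's estimate, Mathlib
`Complex.norm_deriv_le_of_forall_mem_sphere_norm_le`), and after the factor `1/log P₁ = 1/(0.504𝓛⁹)`:

* `lemma123_form_of_steps : U029 c′ → U030 c′ → U031 c′ → U033 c′ →
  ∃ C, ForAllLarge (A → ∀ j ∈ {1,2,3}, ∀ d r ≥ 1, P″₁ < dr < P₂ →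
  ‖sum122 + (log P₁)⁻¹·L′(1,χ)Π(d,r)·rhs033‖ ≤ C·(𝓛¹⁵)⁻¹)` — **the evaluation form of Lemma 12.3**
  (`ε`-free; it is the form §12 (12.16) consumes), from the displayed steps only;
* `lemma123_printed_form_of_steps : … → U034 c′ → ∃ C, ForAllLarge (… →
  ‖sum122 − (L′(1,χ)Π(d,r)/log P₁)(−1 + (−2β₆+β_{j+1}+β_{j+2})log(dr/P″₁))‖
  ≤ 10⁻⁵‖L′(1,χ)‖‖Π(d,r)‖/log P₁ + C·(𝓛¹⁵)⁻¹)` — the printed shape WITH the additive term the text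
  drops between tex L3571 and L3587.

The banked node `Skeleton.Lemma123 c′` (error exactly `10⁻⁵|L′(1,χ)||Π(d,r)|/log P₁`, no additive
term) is NOT derived: the proof's own `O(𝓛⁻¹⁵)` cannot be absorbed into a multiple of `|Π(d,r)|`,
which vanishes whenever `χ(2) = 1`, `2 ∣ d`, `2 ∤ r` (factor `1 − 2⁻¹ − χ(2)2⁻¹` of `Π`) — recorded as a
plan/GAP-LEDGER row (G-d60-2), not repaired here. No new definitions, no new facts; standard axioms.

## References

* Y. Zhang, arXiv:2211.02515v1 (2022), §12 Lemma 12.3 and its proof, pp. 70–71, tex L3551–L3590;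
  (2.10) `α log P = π`, (2.21)–(2.22) `P₁, P₂, β₆`, §12 p. 67 `P″₁, P″₂`.
  [cite: Zhang2022LandauSiegel, §12 Lemma 12.3]
-/

noncomputable section

open Complex Real ComplexConjugate Metric Set MeasureTheory

namespace Literature.NumberTheory.LFunctions.Zhang2022.Typed.Sec12B

open Literature.NumberTheory.LFunctions.Zhang2022.Skeleton

/-! ## Elementary facts about the parameters (`D ≥ 3`) -/

section Params

variable {D : ℕ}

/-- `𝓛 > 1` for `D ≥ 3`. [cite: Zhang2022LandauSiegel, §2 (2.6)] -/
private theorem one_lt_ell' (hD : 3 ≤ D) : 1 < ell D := one_lt_ell hD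

/-- `log P = 𝓛⁹`. [cite: Zhang2022LandauSiegel, §2 (2.6)] -/
private theorem log_bigP_eq (D : ℕ) : Real.log (bigP D) = ell D ^ 9 := by
  rw [bigP, Real.log_exp]

/-- `α = π/𝓛⁹ > 0` for `D ≥ 3`. [cite: Zhang2022LandauSiegel, §2 (2.10)] -/
private theorem alpha_pos_of (hD : 3 ≤ D) : 0 < alpha D := by
  rw [alpha, log_bigP_eq]
  exact div_pos Real.pi_pos (pow_pos (by linarith [one_lt_ell' hD]) _)

/-- `α·log P = π`. [cite: Zhang2022LandauSiegel, §2 (2.10)] -/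
private theorem alpha_mul_log_bigP (hD : 3 ≤ D) : alpha D * Real.log (bigP D) = π := by
  have h : 0 < Real.log (bigP D) := by
    rw [log_bigP_eq]; exact pow_pos (by linarith [one_lt_ell' hD]) _
  rw [alpha, div_mul_cancel₀ _ h.ne']

/-- `P^α = e^π`. [cite: Zhang2022LandauSiegel, §2 (2.10)] -/
private theorem bigP_rpow_alpha (hD : 3 ≤ D) : bigP D ^ alpha D = Real.exp π := by
  rw [bigP, ← Real.exp_mul, ← log_bigP_eq, mul_comm, alpha_mul_log_bigP hD]

/-- `log P₁ = 0.504·𝓛⁹ > 0`. [cite: Zhang2022LandauSiegel, §2 (2.21)] -/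
private theorem log_P1_eq (D : ℕ) : Real.log (Skeleton.P1 D) = 0.504 * ell D ^ 9 := by
  rw [Skeleton.P1, Real.log_rpow (by rw [bigP]; exact Real.exp_pos _), log_bigP_eq]

/-- `log P₁ > 0` for `D ≥ 3`. [cite: Zhang2022LandauSiegel, §2 (2.21)] -/
private theorem log_P1_pos (hD : 3 ≤ D) : 0 < Real.log (Skeleton.P1 D) := by
  rw [log_P1_eq]; exact mul_pos (by norm_num) (pow_pos (by linarith [one_lt_ell' hD]) _)

/-- `1 ≤ P`. [cite: Zhang2022LandauSiegel, §2 (2.6)] -/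
private theorem one_le_bigP (D : ℕ) : 1 ≤ bigP D := by
  rw [bigP]; exact Real.one_le_exp (pow_nonneg (Real.log_natCast_nonneg D) 9)

/-- `P″₁ = P^{0.496}Dt₀ ≥ 1` for `D ≥ 3`. [cite: Zhang2022LandauSiegel, §12 p. 67] -/
private theorem one_le_P1pp (hD : 3 ≤ D) : 1 ≤ P1pp D := by
  have h1 : 1 ≤ bigP D ^ (0.496 : ℝ) := Real.one_le_rpow (one_le_bigP D) (by norm_num)
  have h2 : (1 : ℝ) ≤ D := by exact_mod_cast (le_trans (by norm_num) hD : 1 ≤ D)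
  have h3 : 1 ≤ t0 D := by rw [t0]; exact one_le_pow₀ (one_lt_ell' hD).le
  rw [P1pp]
  calc (1 : ℝ) = 1 * 1 * 1 := by ring
    _ ≤ bigP D ^ (0.496 : ℝ) * D * t0 D := by gcongr

/-- `P₂ ≤ P`. [cite: Zhang2022LandauSiegel, §2 (2.21)] -/
private theorem P2_le_bigP (D : ℕ) : Skeleton.P2 D ≤ bigP D := by
  have hT : 1 ≤ bigT D ^ 10 :=
    one_le_pow₀ (by rw [bigT]; exact Real.one_le_exp (Real.rpow_nonneg (Real.log_natCast_nonneg D) _))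
  have hP : 0 ≤ bigP D ^ (0.5 : ℝ) := Real.rpow_nonneg (Real.exp_pos _).le _
  rw [Skeleton.P2]
  calc bigP D ^ (0.5 : ℝ) / bigT D ^ 10 ≤ bigP D ^ (0.5 : ℝ) := div_le_self hP hT
    _ ≤ bigP D ^ (1 : ℝ) := Real.rpow_le_rpow_of_exponent_le (one_le_bigP D) (by norm_num)
    _ = bigP D := Real.rpow_one _

/-- `P″₂ > 0`. [cite: Zhang2022LandauSiegel, §12 p. 67] -/
private theorem P2pp_pos (hD : 3 ≤ D) : 0 < P2pp D := by
  have h1 : 0 < bigP D ^ (0.5 : ℝ) := Real.rpow_pos_of_pos (Real.exp_pos _) _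
  have h2 : (0 : ℝ) < D := by exact_mod_cast (lt_of_lt_of_le (by norm_num) hD : 0 < D)
  have h3 : 0 < t0 D := by rw [t0]; exact pow_pos (by linarith [one_lt_ell' hD]) _
  rw [P2pp]; exact mul_pos (mul_pos h1 h2) h3

/-- `Re β₆ = 0`. [cite: Zhang2022LandauSiegel, §2 (2.22)] -/
private theorem beta6_re (D : ℕ) : (beta6 D).re = 0 := by
  simp [beta6]

/-- `‖β₆‖ = 3α/2`. [cite: Zhang2022LandauSiegel, §2 (2.22)] -/
private theorem norm_beta6 (hD : 3 ≤ D) : ‖beta6 D‖ = 3 * alpha D / 2 := by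
  have hα := (alpha_pos_of hD).le
  rw [beta6]
  simp [Complex.norm_real, abs_of_nonneg hα]

/-- On `‖w‖ < 1.2α` the denominator `β₆ − w` of the closed form does not vanish.
[cite: Zhang2022LandauSiegel, §12 proof of Lemma 12.3, p. 70] -/
private theorem beta6_sub_ne_zero (hD : 3 ≤ D) {w : ℂ} (hw : ‖w‖ < 1.2 * alpha D) :
    beta6 D - w ≠ 0 := by
  intro h
  have : w = beta6 D := (sub_eq_zero.mp h).symm
  rw [this, norm_beta6 hD] at hw
  linarith [alpha_pos_of hD]

end Params

/-! ## Holomorphy of the two brackets near `|w| ≤ α` -/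

section Holomorphy

variable (c' : ℝ) {D : ℕ} [NeZero D] (χ : DirichletCharacter ℂ D)

omit [NeZero D] in
/-- `bracket123` is entire in `w` (a positive real power times a finite Dirichlet polynomial).
[cite: Zhang2022LandauSiegel, §12 proof of Lemma 12.3, p. 70] -/
theorem differentiable_bracket123 (hD : 3 ≤ D) (j d r : ℕ) (hd : 1 ≤ d) (hr : 1 ≤ r) :
    Differentiable ℂ (bracket123 c' χ j d r) := by
  have hX : 0 < ((d * r : ℕ) : ℝ) / P1pp D := by
    have : 1 ≤ d * r := Nat.one_le_iff_ne_zero.mpr (Nat.mul_ne_zero (by omega) (by omega))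
    exact div_pos (by exact_mod_cast this) (lt_of_lt_of_le one_pos (one_le_P1pp hD))
  have hXc : ((((d * r : ℕ) : ℝ) / P1pp D : ℝ) : ℂ) ≠ 0 := by exact_mod_cast hX.ne'
  intro w
  unfold bracket123 innerSumLow
  refine DifferentiableAt.mul ?_ ?_
  · exact DifferentiableAt.const_cpow (by fun_prop) (Or.inl hXc)
  · refine DifferentiableAt.fun_sum fun l hl => ?_
    have hl1 : 1 ≤ l := (Finset.mem_Ico.mp hl).1
    have hlc : (l : ℂ) ≠ 0 := by exact_mod_cast (by omega : l ≠ 0)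
    refine DifferentiableAt.div (differentiableAt_const _) ?_ ?_
    · exact DifferentiableAt.const_cpow (by fun_prop) (Or.inl hlc)
    · exact fun h => hlc ((Complex.cpow_eq_zero_iff _ _).mp h).1

omit [NeZero D] in
/-- The closed form of `F032` near `|w| ≤ α`: for `‖w‖ < 1.2α`,
`∫₁^{P″₂/dr} y^{β₆−w−1}dy = ((P″₂/dr)^{β₆−w} − 1)/(β₆ − w)` (`β₆ − w ≠ 0` there), so `F032` agrees on
the open disc `‖w‖ < 1.2α` with an explicitly holomorphic function.
[cite: Zhang2022LandauSiegel, §12 proof of Lemma 12.3, p. 70] -/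
theorem F032_eq_closedForm (hD : 3 ≤ D) (j d r : ℕ) (hd : 1 ≤ d) (hr : 1 ≤ r) {w : ℂ}
    (hw : ‖w‖ < 1.2 * alpha D) :
    F032 c' D j d r w =
      ((((d * r : ℕ) : ℝ) / P1pp D : ℝ) : ℂ) ^ (beta6 D - w) *
        (w - beta6 D + betaJ c' D (j + 1) + betaJ c' D (j + 2) +
          betaJ c' D (j + 1) * betaJ c' D (j + 2) *
            ((((P2pp D / ((d * r : ℕ) : ℝ) : ℝ) : ℂ) ^ (beta6 D - w) - 1) / (beta6 D - w))) := by
  have hdr : 0 < ((d * r : ℕ) : ℝ) := by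
    have : 1 ≤ d * r := Nat.one_le_iff_ne_zero.mpr (Nat.mul_ne_zero (by omega) (by omega))
    exact_mod_cast this
  have hY : 0 < P2pp D / ((d * r : ℕ) : ℝ) := div_pos (P2pp_pos hD) hdr
  have hne : beta6 D - w ≠ 0 := beta6_sub_ne_zero hD hw
  have hint : ∫ y in (1 : ℝ)..(P2pp D / ((d * r : ℕ) : ℝ)), (y : ℂ) ^ (beta6 D - w - 1) =
      ((((P2pp D / ((d * r : ℕ) : ℝ) : ℝ) : ℂ) ^ (beta6 D - w) - 1) / (beta6 D - w)) := by
    have h := integral_cpow (a := (1 : ℝ)) (b := P2pp D / ((d * r : ℕ) : ℝ)) (r := beta6 D - w - 1)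
      (Or.inr ⟨fun h => hne (by linear_combination h), Set.notMem_uIcc_of_lt zero_lt_one hY⟩)
    rw [h, sub_add_cancel, Complex.ofReal_one, Complex.one_cpow]
  rw [F032, hint]

omit [NeZero D] in
/-- `F032` is holomorphic on the open disc `‖w‖ < 1.2α` (hence on a neighbourhood of `|w| ≤ α`).
[cite: Zhang2022LandauSiegel, §12 proof of Lemma 12.3, p. 70] -/
theorem differentiableOn_F032 (hD : 3 ≤ D) (j d r : ℕ) (hd : 1 ≤ d) (hr : 1 ≤ r) :
    DifferentiableOn ℂ (F032 c' D j d r) (ball (0 : ℂ) (1.2 * alpha D)) := by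
  have hdr : 0 < ((d * r : ℕ) : ℝ) := by
    have : 1 ≤ d * r := Nat.one_le_iff_ne_zero.mpr (Nat.mul_ne_zero (by omega) (by omega))
    exact_mod_cast this
  have hX : ((((d * r : ℕ) : ℝ) / P1pp D : ℝ) : ℂ) ≠ 0 := by
    exact_mod_cast (div_pos hdr (lt_of_lt_of_le one_pos (one_le_P1pp hD))).ne'
  have hY : (((P2pp D / ((d * r : ℕ) : ℝ) : ℝ) : ℂ)) ≠ 0 := by
    exact_mod_cast (div_pos (P2pp_pos hD) hdr).ne'
  intro w hw
  have hw' : ‖w‖ < 1.2 * alpha D := by simpa using hw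
  have hne : beta6 D - w ≠ 0 := beta6_sub_ne_zero hD hw'
  -- the explicit function, differentiable at `w`
  have hG : DifferentiableAt ℂ (fun w : ℂ =>
      ((((d * r : ℕ) : ℝ) / P1pp D : ℝ) : ℂ) ^ (beta6 D - w) *
        (w - beta6 D + betaJ c' D (j + 1) + betaJ c' D (j + 2) +
          betaJ c' D (j + 1) * betaJ c' D (j + 2) *
            ((((P2pp D / ((d * r : ℕ) : ℝ) : ℝ) : ℂ) ^ (beta6 D - w) - 1) / (beta6 D - w)))) w := by
    refine DifferentiableAt.mul (DifferentiableAt.const_cpow (by fun_prop) (Or.inl hX)) ?_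
    refine DifferentiableAt.add (by fun_prop) (DifferentiableAt.mul (differentiableAt_const _) ?_)
    refine DifferentiableAt.div ?_ (by fun_prop) hne
    exact (DifferentiableAt.const_cpow (by fun_prop) (Or.inl hY)).sub (differentiableAt_const _)
  -- `F032` agrees with it near `w`
  have hball : IsOpen (ball (0 : ℂ) (1.2 * alpha D)) := isOpen_ball
  refine (hG.congr_of_eventuallyEq ?_).differentiableWithinAt
  filter_upwards [hball.mem_nhds hw] with z hz
  exact F032_eq_closedForm c' hD j d r hd hr (by simpa using hz)

end Holomorphy

/-! ## The Cauchy step: `O(𝓛⁻¹⁵)` on `|w| = α` ⇒ `O(𝓛⁻⁶)` for the derivative at `0` -/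

section CauchyStep

variable (c' : ℝ) {D : ℕ} [NeZero D] (χ : DirichletCharacter ℂ D)

omit [NeZero D] in
/-- On the circle `|w| = α`: `|(dr/P″₁)^{β₆−w}| = (dr/P″₁)^{−Re w} ≤ (dr/P″₁)^{α} ≤ P^{α} = e^{π}`
(`1 < dr/P″₁ ≤ dr < P₂ ≤ P` as `P″₁ ≥ 1`). [cite: Zhang2022LandauSiegel, §12 proof of Lemma 12.3, p. 70] -/
theorem norm_Xpow_le (hD : 3 ≤ D) (d r : ℕ) (h1 : P1pp D < ((d * r : ℕ) : ℝ))
    (h2 : ((d * r : ℕ) : ℝ) < Skeleton.P2 D) {w : ℂ} (hw : ‖w‖ = alpha D) :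
    ‖((((d * r : ℕ) : ℝ) / P1pp D : ℝ) : ℂ) ^ (beta6 D - w)‖ ≤ Real.exp π := by
  have hP1pp : 1 ≤ P1pp D := one_le_P1pp hD
  have hP1pp0 : 0 < P1pp D := lt_of_lt_of_le one_pos hP1pp
  set X : ℝ := ((d * r : ℕ) : ℝ) / P1pp D with hXdef
  have hX1 : 1 ≤ X := (one_le_div hP1pp0).mpr h1.le
  have hX0 : 0 < X := lt_of_lt_of_le one_pos hX1
  have hXP : X ≤ bigP D := by
    calc X ≤ ((d * r : ℕ) : ℝ) := div_le_self (by positivity) hP1pp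
      _ ≤ bigP D := (h2.le.trans (P2_le_bigP D))
  rw [Complex.norm_cpow_eq_rpow_re_of_pos hX0, Complex.sub_re, beta6_re, zero_sub]
  have hre : -w.re ≤ alpha D := by
    have := Complex.abs_re_le_norm w
    rw [hw] at this
    linarith [neg_abs_le w.re]
  calc X ^ (-w.re) ≤ X ^ alpha D := Real.rpow_le_rpow_of_exponent_le hX1 hre
    _ ≤ bigP D ^ alpha D := Real.rpow_le_rpow hX0.le hXP (alpha_pos_of hD).le
    _ = Real.exp π := bigP_rpow_alpha hD

/-- **The derivative at `0` of the error bracket.** If on `|w| = α` the inner sum is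
`L′(1,χ)Π(d,r)·circ030(w) + O(𝓛⁻¹⁵)` (u030) and `circ030(w)` is the displayed expression (u031),
then the derivative at `0` of `E(w) = bracket123(w) − L′(1,χ)Π(d,r)F032(w)` is `≤ (e^{π}C/α)𝓛⁻¹⁵`
in norm (Cauchy's estimate on `|w| = α`). [cite: Zhang2022LandauSiegel, §12 proof of Lemma 12.3, p. 70] -/
theorem norm_deriv_error_le (hD : 3 ≤ D) {C : ℝ} (j d r : ℕ) (hd : 1 ≤ d) (hr : 1 ≤ r)
    (h1 : P1pp D < ((d * r : ℕ) : ℝ)) (h2 : ((d * r : ℕ) : ℝ) < Skeleton.P2 D)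
    (h30 : ∀ w : ℂ, ‖w‖ = alpha D →
      ‖innerSumLow c' χ j d r w - deriv χ.LFunction 1 * PiW χ d r * circ030 c' D j d r w‖ ≤
        C * (ell D ^ 15)⁻¹)
    (h31 : ∀ w : ℂ, ‖w‖ = alpha D →
      circ030 c' D j d r w =
        w - beta6 D + betaJ c' D (j + 1) + betaJ c' D (j + 2) +
          betaJ c' D (j + 1) * betaJ c' D (j + 2) *
            ∫ y in (1 : ℝ)..(P2pp D / ((d * r : ℕ) : ℝ)), (y : ℂ) ^ (beta6 D - w - 1)) :
    ‖deriv (fun w => bracket123 c' χ j d r w -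
        deriv χ.LFunction 1 * PiW χ d r * F032 c' D j d r w) 0‖ ≤
      Real.exp π * C * (ell D ^ 15)⁻¹ / alpha D := by
  have hα : 0 < alpha D := alpha_pos_of hD
  refine Complex.norm_deriv_le_of_forall_mem_sphere_norm_le hα ?_ ?_
  · -- holomorphy on a neighbourhood of the closed disc
    have hsub : closedBall (0 : ℂ) (alpha D) ⊆ ball (0 : ℂ) (1.2 * alpha D) :=
      closedBall_subset_ball (by linarith)
    refine DifferentiableOn.diffContOnCl_ball (U := ball (0 : ℂ) (1.2 * alpha D)) ?_ hsub
    exact ((differentiable_bracket123 c' χ hD j d r hd hr).differentiableOn).sub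
      ((differentiableOn_F032 c' hD j d r hd hr).const_mul _)
  · intro w hw
    have hw' : ‖w‖ = alpha D := by simpa using hw
    have key := h30 w hw'
    have hF : F032 c' D j d r w =
        ((((d * r : ℕ) : ℝ) / P1pp D : ℝ) : ℂ) ^ (beta6 D - w) * circ030 c' D j d r w := by
      rw [F032, h31 w hw']
    have hE : bracket123 c' χ j d r w - deriv χ.LFunction 1 * PiW χ d r * F032 c' D j d r w =
        ((((d * r : ℕ) : ℝ) / P1pp D : ℝ) : ℂ) ^ (beta6 D - w) *
          (innerSumLow c' χ j d r w - deriv χ.LFunction 1 * PiW χ d r * circ030 c' D j d r w) := by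
      rw [bracket123, hF]; ring
    rw [hE, norm_mul]
    have hXn := norm_Xpow_le hD d r h1 h2 hw'
    have hC0 : 0 ≤ C * (ell D ^ 15)⁻¹ := le_trans (norm_nonneg _) key
    calc ‖((((d * r : ℕ) : ℝ) / P1pp D : ℝ) : ℂ) ^ (beta6 D - w)‖ *
          ‖innerSumLow c' χ j d r w - deriv χ.LFunction 1 * PiW χ d r * circ030 c' D j d r w‖
        ≤ Real.exp π * (C * (ell D ^ 15)⁻¹) :=
          mul_le_mul hXn key (norm_nonneg _) (Real.exp_pos _).le
      _ = Real.exp π * C * (ell D ^ 15)⁻¹ := by ring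

end CauchyStep

/-! ## Lemma 12.3 in evaluation form, from the displayed steps -/

section Edges123

variable (c' : ℝ)

/-- **Lemma 12.3, evaluation form, from u029, u030, u031, u033**: for `1 ≤ j ≤ 3`, `d, r ≥ 1`,
`P″₁ < dr < P₂`, `Σ_l χ(l)ϰ̄₁₃(drl)ξ_j(l;d,r)/l = −(L′(1,χ)Π(d,r)/log P₁)·[rhs033] + O(𝓛⁻¹⁵)`, the
implied constant being `e^{π}C/(0.504π)` for the constant `C` of u030. Kernel-checked deduction; the
analytic content is exactly u030 (and the exact identities u029, u031, u033, which L3-t5 proves in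
the tree). [cite: Zhang2022LandauSiegel, §12 Lemma 12.3 (proof), pp. 70–71, tex L3558–L3586] -/
theorem lemma123_form_of_steps (h29 : U029 c') (h30 : U030 c') (h31 : U031 c') (h33 : U033 c') :
    ∃ C : ℝ, ForAllLarge fun D _ χ => AssumptionA D χ →
      ∀ j ∈ ({1, 2, 3} : Finset ℕ), ∀ d r : ℕ, 1 ≤ d → 1 ≤ r →
        P1pp D < ((d * r : ℕ) : ℝ) → ((d * r : ℕ) : ℝ) < Skeleton.P2 D →
          ‖sum122 c' χ j d r +
              1 / (Real.log (Skeleton.P1 D) : ℂ) * (deriv χ.LFunction 1 * PiW χ d r) *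
                rhs033 c' D j d r‖ ≤ C * (ell D ^ 15)⁻¹ := by
  obtain ⟨C, h30'⟩ := h30
  obtain ⟨D₀, hall⟩ := ((h29.and h30').and h31).and h33
  refine ⟨Real.exp π * |C| / (0.504 * π), max D₀ 3, fun D _ χ hD hq hp hA j hj d r hd hr h1 h2 => ?_⟩
  have hD₀ : D₀ ≤ D := le_trans (le_max_left _ _) hD
  have hD3 : 3 ≤ D := le_trans (le_max_right _ _) hD
  obtain ⟨⟨⟨k29, k30⟩, k31⟩, k33⟩ := hall D χ hD₀ hq hp
  have e29 := k29 j hj d r hd hr h1 h2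
  have e33 := k33 j hj d r hd hr h1 h2
  have hα : 0 < alpha D := alpha_pos_of hD3
  have hℓ : 0 < ell D := by linarith [one_lt_ell' hD3]
  -- u030 with `|C|` in place of `C`
  have k30abs : ∀ w : ℂ, ‖w‖ = alpha D →
      ‖innerSumLow c' χ j d r w - deriv χ.LFunction 1 * PiW χ d r * circ030 c' D j d r w‖ ≤
        |C| * (ell D ^ 15)⁻¹ := fun w hw =>
    (k30 hA j hj d r hd hr h1 h2 w hw).trans
      (mul_le_mul_of_nonneg_right (le_abs_self C) (inv_nonneg.mpr (pow_nonneg hℓ.le _)))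
  have hderiv := norm_deriv_error_le c' χ hD3 j d r hd hr h1 h2 k30abs
    (fun w hw => k31 j hj d r hd hr h1 h2 w hw)
  -- differentiability at `0` of the two brackets
  have hB : DifferentiableAt ℂ (bracket123 c' χ j d r) 0 :=
    (differentiable_bracket123 c' χ hD3 j d r hd hr) 0
  have hF : DifferentiableAt ℂ (F032 c' D j d r) 0 :=
    (differentiableOn_F032 c' hD3 j d r hd hr).differentiableAt
      (isOpen_ball.mem_nhds (mem_ball_self (by positivity)))
  have hsplit : deriv (fun w => bracket123 c' χ j d r w -
      deriv χ.LFunction 1 * PiW χ d r * F032 c' D j d r w) 0 =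
      deriv (bracket123 c' χ j d r) 0 -
        deriv χ.LFunction 1 * PiW χ d r * deriv (F032 c' D j d r) 0 := by
    rw [deriv_fun_sub hB (hF.const_mul _), deriv_const_mul _ hF]
  rw [hsplit, e33] at hderiv
  -- the identity: sum122 + (1/log P₁)·L′Π·rhs033 = −(1/log P₁)·(derivative of the error bracket)
  have hlogP1 : 0 < Real.log (Skeleton.P1 D) := log_P1_pos hD3
  have hlogc : (Real.log (Skeleton.P1 D) : ℂ) ≠ 0 := by exact_mod_cast hlogP1.ne'
  have hid : sum122 c' χ j d r +
      1 / (Real.log (Skeleton.P1 D) : ℂ) * (deriv χ.LFunction 1 * PiW χ d r) * rhs033 c' D j d r =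
      -(1 / (Real.log (Skeleton.P1 D) : ℂ)) *
        (deriv (bracket123 c' χ j d r) 0 -
          deriv χ.LFunction 1 * PiW χ d r * rhs033 c' D j d r) := by
    rw [e29]; ring
  rw [hid, norm_mul, norm_neg, norm_div, norm_one, Complex.norm_real, Real.norm_eq_abs,
    abs_of_pos hlogP1]
  -- numerics: (1/log P₁)·(e^π|C|𝓛⁻¹⁵/α) = e^π|C|/(0.504π)·𝓛⁻¹⁵
  have hval : 1 / Real.log (Skeleton.P1 D) * (Real.exp π * |C| * (ell D ^ 15)⁻¹ / alpha D) =
      Real.exp π * |C| / (0.504 * π) * (ell D ^ 15)⁻¹ := by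
    rw [log_P1_eq, alpha, log_bigP_eq]
    have h9 : ell D ^ 9 ≠ 0 := pow_ne_zero _ hℓ.ne'
    field_simp
  calc 1 / Real.log (Skeleton.P1 D) *
        ‖deriv (bracket123 c' χ j d r) 0 - deriv χ.LFunction 1 * PiW χ d r * rhs033 c' D j d r‖
      ≤ 1 / Real.log (Skeleton.P1 D) * (Real.exp π * |C| * (ell D ^ 15)⁻¹ / alpha D) :=
        mul_le_mul_of_nonneg_left hderiv (by positivity)
    _ = Real.exp π * |C| / (0.504 * π) * (ell D ^ 15)⁻¹ := hval

/-- **Lemma 12.3 in its printed shape, with the additive term kept**: adding u034 (the bound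
`|ε₂ⱼ(dr)| < 10⁻⁵` on the explicit `rhs033`, AS PRINTED — certified numerics N-07 report it fails
pointwise; it is a hypothesis here, not asserted), `Σ_l χ(l)ϰ̄₁₃(drl)ξ_j(l;d,r)/l =
(L′(1,χ)Π(d,r)/log P₁)(−1 + (−2β₆+β_{j+1}+β_{j+2})log(dr/P″₁)) + θ·10⁻⁵|L′(1,χ)||Π(d,r)|/log P₁
+ O(𝓛⁻¹⁵)`, `|θ| ≤ 1`. The banked `Skeleton.Lemma123` omits the `O(𝓛⁻¹⁵)`.
[cite: Zhang2022LandauSiegel, §12 Lemma 12.3, pp. 70–71, tex L3551–L3590] -/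
theorem lemma123_printed_form_of_steps (h29 : U029 c') (h30 : U030 c') (h31 : U031 c')
    (h33 : U033 c') (h34 : U034 c') :
    ∃ C : ℝ, ForAllLarge fun D _ χ => AssumptionA D χ →
      ∀ j ∈ ({1, 2, 3} : Finset ℕ), ∀ d r : ℕ, 1 ≤ d → 1 ≤ r →
        P1pp D < ((d * r : ℕ) : ℝ) → ((d * r : ℕ) : ℝ) < Skeleton.P2 D →
          ‖sum122 c' χ j d r -
              deriv χ.LFunction 1 * PiW χ d r / (Real.log (Skeleton.P1 D) : ℂ) *
                (-1 + (-2 * beta6 D + betaJ c' D (j + 1) + betaJ c' D (j + 2)) *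
                  (Real.log (((d * r : ℕ) : ℝ) / P1pp D) : ℂ))‖ ≤
            1e-5 * ‖deriv χ.LFunction 1‖ * ‖PiW χ d r‖ / Real.log (Skeleton.P1 D) +
              C * (ell D ^ 15)⁻¹ := by
  obtain ⟨C, hC⟩ := lemma123_form_of_steps c' h29 h30 h31 h33
  obtain ⟨D₀, hall⟩ := hC.and h34
  refine ⟨C, max D₀ 3, fun D _ χ hD hq hp hA j hj d r hd hr h1 h2 => ?_⟩
  have hD₀ : D₀ ≤ D := le_trans (le_max_left _ _) hD
  have hD3 : 3 ≤ D := le_trans (le_max_right _ _) hD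
  obtain ⟨kC, k34⟩ := hall D χ hD₀ hq hp
  have eC := kC hA j hj d r hd hr h1 h2
  have e34 := k34 j hj d r hd hr h1 h2
  have hlogP1 : 0 < Real.log (Skeleton.P1 D) := log_P1_pos hD3
  set L : ℂ := deriv χ.LFunction 1 * PiW χ d r with hL
  set M : ℂ := (-1 + (-2 * beta6 D + betaJ c' D (j + 1) + betaJ c' D (j + 2)) *
    (Real.log (((d * r : ℕ) : ℝ) / P1pp D) : ℂ)) with hM
  set ρ : ℂ := rhs033 c' D j d r -
    (1 - (-2 * beta6 D + betaJ c' D (j + 1) + betaJ c' D (j + 2)) *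
      (Real.log (((d * r : ℕ) : ℝ) / P1pp D) : ℂ)) with hρ
  -- algebra: sum122 − (L/log P₁)·M = [sum122 + (1/log P₁)·L·rhs033] − (L/log P₁)·ρ
  have hid : sum122 c' χ j d r - L / (Real.log (Skeleton.P1 D) : ℂ) * M =
      (sum122 c' χ j d r + 1 / (Real.log (Skeleton.P1 D) : ℂ) * L * rhs033 c' D j d r) -
        L / (Real.log (Skeleton.P1 D) : ℂ) * ρ := by
    rw [hM, hρ]; ring
  rw [hid]
  have hb : ‖L / (Real.log (Skeleton.P1 D) : ℂ) * ρ‖ ≤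
      1e-5 * ‖deriv χ.LFunction 1‖ * ‖PiW χ d r‖ / Real.log (Skeleton.P1 D) := by
    rw [norm_mul, norm_div, Complex.norm_real, Real.norm_eq_abs, abs_of_pos hlogP1, hL, norm_mul]
    have hρ' : ‖ρ‖ ≤ 1e-5 := e34.le
    have hnn : 0 ≤ ‖deriv χ.LFunction 1‖ * ‖PiW χ d r‖ / Real.log (Skeleton.P1 D) := by positivity
    calc ‖deriv χ.LFunction 1‖ * ‖PiW χ d r‖ / Real.log (Skeleton.P1 D) * ‖ρ‖
        ≤ ‖deriv χ.LFunction 1‖ * ‖PiW χ d r‖ / Real.log (Skeleton.P1 D) * 1e-5 :=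
          mul_le_mul_of_nonneg_left hρ' hnn
      _ = 1e-5 * ‖deriv χ.LFunction 1‖ * ‖PiW χ d r‖ / Real.log (Skeleton.P1 D) := by ring
  calc ‖(sum122 c' χ j d r + 1 / (Real.log (Skeleton.P1 D) : ℂ) * L * rhs033 c' D j d r) -
        L / (Real.log (Skeleton.P1 D) : ℂ) * ρ‖
      ≤ ‖sum122 c' χ j d r + 1 / (Real.log (Skeleton.P1 D) : ℂ) * L * rhs033 c' D j d r‖ +
        ‖L / (Real.log (Skeleton.P1 D) : ℂ) * ρ‖ := norm_sub_le _ _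
    _ ≤ C * (ell D ^ 15)⁻¹ +
        1e-5 * ‖deriv χ.LFunction 1‖ * ‖PiW χ d r‖ / Real.log (Skeleton.P1 D) := add_le_add eC hb
    _ = 1e-5 * ‖deriv χ.LFunction 1‖ * ‖PiW χ d r‖ / Real.log (Skeleton.P1 D) +
        C * (ell D ^ 15)⁻¹ := add_comm _ _

end Edges123

end Literature.NumberTheory.LFunctions.Zhang2022.Typed.Sec12B
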